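/-
Copyright (c) 2026 the pub-hodgecm-mathlib formalisation cell (harness21).  Prover seat hodgecm-mathlib-K2E3-p35 (g0), HCML Track B «K2-LIT» (close-out strike line L4
`stub_StCharTS`), h413 = `stmt-HodgeConjecture-24833`, line `K2_E3_EllipticInputs`, PART «SC» socket (SC-an)₂ `sig_K2E3SupercuspidalTruncatedCharAnalyticTwo`, the (M5h₂)
chain (dealer K2E3-plan (g4) L4 EMIT #2 2026-09-04T14:55:54Z, countersigned K2-lead (g2) 14:56:05Z; deal «p35 → TorusSlicing₂»): the `U(1,1)` twin of ★ (M5b)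
`K2E3TruncatedCharTorusSlicing` (K2E5-p01 (g4), p856875) — THE `A`-VOLUME SLICING OF A TRUNCATED ORBITAL INTEGRAL ALONG THE DIAGONAL TORUS OF `U(σ, Φ₂)(K)`.  2026-09-04.
-/
import Summits.HodgeConjecture.HodgeConjecture.Theorems.K2E3TruncatedCharTorusSlicing            -- ★ (M5b) at `Φ₃` (p856875): its GENERIC §1 (`fiberLIntegral_indicator_one_mk`, `lintegral_conj_le_of_fibre_le`: Weil unfolding along `G → G ⧸ H` for ANY lcsc `G`) is REUSED BY NAME; brings ★ `InvariantQuotientUnfolding` (`unfoldingConstant`, `unfoldingConstant_pos`), ★ `InvariantQuotientConjugacySum` (`descConj`), ★ `isClosed_torusU_of_t1Space`, ★ `CartanUnique`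
import Summits.HodgeConjecture.HodgeConjecture.Theorems.K2E3ConjugatorHeightControlRankOneTwo   -- ★∕📤 (D2)₂ (this seat, FILE 0): (D2b)₂ `mem_heightBall_mul_torusU_of_conj_mem_support` (currency `2m_θ+2λ`) and `…_sharp` (`m_θ+λ`); brings ★ U2Torus `diag_mem_heightBall_iff` (`Φ₂`, no `hϖ`)
import HarnessLib

/-!
# h413 ∕ Track B «K2-LIT», (SC-an)₂ ∕ (M5h₂) chain, brick [M5-slice]₂: THE `A`-VOLUME SLICING OF A TRUNCATED ORBITAL INTEGRAL ALONG THE DIAGONAL TORUS OF `U(σ, Φ₂)(K)` —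
# `c · ∫_{Ω_R} |θ(x g x⁻¹)| dx ≤ (2(R + h(g)) + 1) · ρ(T ∩ Ω₀) · ∫_{G⧸T} |θ(ẋ t ẋ⁻¹)| dẋ` (Harish-Chandra 1970, Part VII §3 pp. 71–72), the `U(1,1)` twin of ★ (M5b)

Cell `pub/hodgecm-mathlib`, crux H413 = `stmt-HodgeConjecture-24833`, route of record `HCCMUnconditional`; chair K2-lead (g2), LINE-LEAD∕dealer K2E3-plan (g4), chain desk
K2E3-p27 (g0), cone map K2E3-p33 (g0), binder desk K2E3-p23 (g7).  THEOREMS ONLY (no `def`, no `instance`, no `notation`, no named-fact hypothesis, no `sorry`); lane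
`--supports stmt-HodgeConjecture-24833 --as helper`, count-neutral.

THE PRINT.  [HarishChandra1970, Part VII §3 pp. 71–72], proof of Theorem 16 (the locally-integrable majorant of the truncated characters `Θ_T`), the step between
Theorem 20 ([M4]₂ `K2E3SupercuspidalTruncatedCharThm20Two`, which localises `Θ_T(γ^y)` to a height ball) and Theorem 14 (the bounded normalised orbital integral over
`G ⧸ A`): «`|Θ_T(γ^y)| ≤ ∫ Φ_γ(x y₀⁻¹) |θ(γ^x)| dx*  …  = ∫_{G⧸A} |θ(γ^{x̄})| dx̄ · ∫_A Φ_γ(x a y₀⁻¹) da`, and `∫_A Φ_γ(…) da ≤ c₃ (1 + |λ(γ)|)^{4ℓ}`» — the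
integral over the height ball `Ω_R` of `x ↦ |θ(x g x⁻¹)|`, `g = y t y⁻¹` with `t` in the split torus `A = T`, is SLICED along the fibres `x A` of `G → G ⧸ A`; the
`A`-volume of a fibre slice `{a ∈ A : x a ∈ Ω_R}` is LINEAR in `R +` (the height of a representative of `x A`), and Harish-Chandra's support control (p. 71 (ii),
(D2b)₂ `mem_heightBall_mul_torusU_of_conj_mem_support`) bounds that height on the support of the integrand by `h(g) = 2 m_θ + 2λ(t)` (+ the height `s` of the
conjugator `y`, (D2a)₂).  Here at RANK ONE (`ℓ = 1`) for the diagonal torus `T = {diag(α, σ(α)⁻¹)}` of `U(σ, Φ₂)(K) = U(1,1)` in the height-ball currency of ★ p856390 ∕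
★ U2Torus (`g ∈ Ω_m ↔ |ϖ^m g_{ij}| ≤ 1 ∧ |ϖ^m (g⁻¹)_{ij}| ≤ 1`), with EXPLICIT constants and for ANY `G`-invariant measure `μQ` on `G ⧸ T`:
`c · ∫⁻_{Ω R} Θ(x (y t y⁻¹) x⁻¹) dμ ≤ (2 (R + s + 2 m_θ + 2λ) + 1) · ρ(T ∩ Ω 0) · ∫⁻_{G⧸T} Θ(ẋ t ẋ⁻¹) dμQ(ẋ)`, `c = unfoldingConstant T ρ μQ μ` the Weil constant
(`∫⁻_{G⧸T} ∫⁻_T f(x a) dρ dμQ = c ∫⁻_G f dμ`, ★ `InvariantQuotientUnfolding`).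
WHAT CHANGES FROM `N = 3` (honest `2 × 2` algebra; everything else is the ★ template token-for-token with `Fin 3 ↦ Fin 2`).  §1 of ★ (M5b) (the GENERIC slicing along
`G → G ⧸ H` by Weil unfolding with a factor constant on cosets) is any-`G` and is IMPORTED, not repeated.  §2: the basic torus element is `s = diag(ϖ, σ(ϖ)⁻¹)` (no unit
middle entry); `diag(d) ∈ Ω n ↔ |ϖ^n d₀| ≤ 1 ∧ |ϖ^n d₀⁻¹| ≤ 1` is ★ U2Torus `diag_mem_heightBall_iff` (no `hϖ` binder), so `T ∩ Ω n` is again covered by the `2n+1`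
translates `s^{-j}(T ∩ Ω 0)`, `|j| ≤ n`, and `ρ(T ∩ Ω n) ≤ (2n+1) ρ(T ∩ Ω 0)` keeps its `N = 3` shape (`measure_torusU_heightBall_le`); `torusU_fibre_subset`,
`torusU_comm_of_glDiagonal`, `measure_torusU_heightBall_zero_lt_top` and the conjugator shift `lintegral_heightBall_conj_conj_le` are rank-blind and are stated here for
ANY size `N` and form `J` (§2b, §3; same explicit-argument order as ★ (M5b), so `Fin 2` and `Fin 3` callers use them alike).  The support radius enters only through
(D2b)₂, which exports BOTH the currency-verbatim `h = 2 m_θ + 2λ` (so the heads below keep the `N = 3` constants every (M5h₂) consumer ports token-for-token) and the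
sharp `h = m_θ + λ` (`lintegral_heightBall_conj_le_sharp`).  The height-ball hypotheses `hmem hinv hmul` are THEOREM binders here (same explicit-argument positions as the
★ template's section variables: `… Ω hmem ρ n`, `… μ ρ μQ Ω hmem hinv hmul hΘ …`).
HEADS (ns `…Cruxes.H413.K2E3TruncatedCharTorusSlicingTwo`, names suffix-free = the ★ (M5b) names): §2 `exists_mem_torusU_coe_zero_eq`, **`measure_torusU_heightBall_le`**,
`torusU_fibre_subset`, `torusU_comm_of_glDiagonal`; §3 `measure_torusU_heightBall_zero_lt_top`, `lintegral_heightBall_conj_conj_le` (conjugator shift),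
**`lintegral_heightBall_conj_le_of_support`** (at `t ∈ T`, support `⊆ Ω h · T`), **`lintegral_heightBall_conj_le`** (`g = y t y⁻¹`, `t = diag d` regular, `y ∈ Ω s`; constants
verbatim) + `lintegral_heightBall_conj_le_sharp`, `lintegral_heightBall_conj_le_div` (divided by `c > 0`) and the `ℝ`-valued `hball` shape **`integral_heightBall_norm_conj_le`**
(binders `hμQ hρ hθc hθ ht hd hreg hy R hfin` exactly as ★ (M5b), `Fin 3 ↦ Fin 2` — the head (M5e-1)₂ `K2E3SupercuspBallBoundSplitAssemblyTwo` :158-twin consumes).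
CURRENCY: ★ U2Torus ∕ (D2)₂ (`K` with `Valued K ℤᵐ⁰`, `σ` with `hσv hσσ`, `J = Φ₂` via `hJ`, uniformiser `ϖ`, `Ω : CompactExhaustion` with `hmem hinv hmul`; the Haar
measure `μ` of `↥U` right invariant); the quotient `↥U ⧸ torusU σ J` carries a Borel structure given as hypotheses and ANY `G`-invariant measure `μQ` finite on compacta;
`ρ` is any left-invariant measure on `↥(torusU σ J)`, s-finite and finite on compacta; `[hT : IsClosed ↑(torusU σ J)]` is discharged by `haveI := isClosed_torusU_of_t1Space σ J`.

HONEST LABEL.  HC_CM is proved only modulo the 7 printed citations (2 remaining named inputs: hLiu418 = `stmt-HodgeConjecture-24832`, h413 = `stmt-HodgeConjecture-24833`)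
until rung 0 closes; count-neutral helper (an intermediate of (SC-an)₂, not a printed citation of HC_CM); (SC-an)₂ is NOT ★ until COLL₂ + NC₂ + the whole (M5h₂) chain land
— in particular the quotient integral on the right still needs (D1-split)₂ «`|D(t)|^{1∕2} ∫_{G⧸T} |θ(t^ẋ)| dẋ ≤ C_θ`» (Theorem 14 at rank one for `U(1,1)`).

## References
* [HarishChandra1970] Harish-Chandra (notes by G. van Dijk), *Harmonic Analysis on Reductive p-adic Groups*, LNM 162 (1970), Part VII §2 Theorems 18–19 and Corollary
  p. 69; §3 pp. 71–72 (proof of Theorem 16: eq. (1), the `∫_A Φ_γ da` bound); Part VI §8 Theorem 14 p. 60.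
* [Folland1995] G. B. Folland, *A Course in Abstract Harmonic Analysis* (1995), §2.6 Thm. 2.49, (2.52) (Weil's formula on `G ⧸ H`).
* [Rogawski1990] J. D. Rogawski, *Automorphic Representations of Unitary Groups in Three Variables*, Ann. of Math. Stud. 123 (1990), §1.9 p. 8, §1.10 p. 9 (`U(1,1)`,
  `M = {d(α, ᾱ⁻¹)}`).
-/

set_option autoImplicit false
set_option linter.dupNamespace false  -- the mandated namespace repeats the single-problem summit's segment (`HodgeConjecture.HodgeConjecture`)

noncomputable section

open MeasureTheory Measure Set Filter Topology
open scoped NNReal ENNReal Pointwise Matrix MatrixGroups WithZero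
open Literature.NumberTheory.Automorphic Literature.NumberTheory.Automorphic.UnitaryGroup
open Literature.MeasureTheory.Group
open Summit.HodgeConjecture.HodgeConjecture.Cruxes.H413.K2E3CuspFormCancellationU2Torus

/- The coset space `↥U ⧸ T` carries a Borel structure given as HYPOTHESES `[MeasurableSpace (↥U ⧸ T)] [BorelSpace (↥U ⧸ T)]` (local instances take precedence over
Mathlib's quotient σ-algebra; same convention as ★ (M5b), ★ `F0P3cStCharTSUpTrU2JacModel`, ★ (L8b)).  §1 of ★ (M5b) (generic slicing) is used BY NAME. -/

namespace Summit.HodgeConjecture.HodgeConjecture.Cruxes.H413.K2E3TruncatedCharTorusSlicingTwo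

/-! ## §2a The diagonal torus of `U(σ, Φ₂)(K)`: the basic torus element and the `ρ`-mass of `T ∩ Ω_n` -/

section Torus

variable {K : Type*} [Field K] [Valued K ℤᵐ⁰] (σ : K →+* K) (hσv : ∀ x, Valued.v (σ x) = Valued.v x) (hσσ : ∀ x, σ (σ x) = x)
  {J : Matrix (Fin 2) (Fin 2) K} (hJ : J = (StdForm.antidiagonal 2).over K) {ϖ : K} (hϖ : Valued.v ϖ = WithZero.exp (-1 : ℤ))
  (Ω : ℕ → Set ↥(unitaryGroupOfForm σ J))

include hσσ hJ hϖ in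
/-- **THE BASIC TORUS ELEMENT `s = diag(ϖ, σ(ϖ)⁻¹) ∈ T`** of `U(1,1)` (`σ(σ(ϖ)⁻¹) ϖ = 1`, `σ(ϖ) σ(ϖ)⁻¹ = 1`): an element of the diagonal torus whose first coordinate is the
uniformiser (at `N = 3` it was `diag(ϖ, 1, σ(ϖ)⁻¹)`; here there is no middle entry). [cite: Rogawski1990, §1.9 p. 8; §1.10 p. 9] -/
theorem exists_mem_torusU_coe_zero_eq :
    ∃ s : ↥(unitaryGroupOfForm σ J), s ∈ torusU σ J ∧ ∃ e : Fin 2 → Kˣ, glDiagonal 2 K e = (s : GL (Fin 2) K) ∧ (e 0 : K) = ϖ := by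
  have hϖ0 : ϖ ≠ 0 := by
    intro h
    rw [h, map_zero] at hϖ
    exact WithZero.coe_ne_zero hϖ.symm
  have hσϖ0 : σ ϖ ≠ 0 := (map_ne_zero σ).2 hϖ0
  let e : Fin 2 → Kˣ := ![Units.mk0 ϖ hϖ0, (Units.mk0 (σ ϖ) hσϖ0)⁻¹]
  have he0 : (e 0 : K) = ϖ := by simp [e]
  have he1 : (e 1 : K) = (σ ϖ)⁻¹ := by simp [e]
  have hU : glDiagonal 2 K e ∈ unitaryGroupOfForm σ J := by
    rw [hJ, glDiagonal_mem_unitaryGroupOfForm_antidiagonal_iff σ 2 e]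
    intro i
    fin_cases i
    · show σ (e (Fin.rev 0) : K) * (e 0 : K) = 1
      rw [show Fin.rev (0 : Fin 2) = 1 by decide, he1, he0, map_inv₀, hσσ, inv_mul_cancel₀ hϖ0]
    · show σ (e (Fin.rev 1) : K) * (e 1 : K) = 1
      rw [show Fin.rev (1 : Fin 2) = 0 by decide, he0, he1, mul_inv_cancel₀ hσϖ0]
  exact ⟨⟨glDiagonal 2 K e, hU⟩, (mem_torusU_iff _).2 ⟨e, rfl⟩, e, rfl, he0⟩

include hσv hσσ hJ hϖ in
/-- **THE `ρ`-MASS OF `T ∩ Ω_n` IS LINEAR IN `n`**: `ρ{a ∈ T : a ∈ Ω n} ≤ (2n + 1) · ρ{a ∈ T : a ∈ Ω 0}` for every left-invariant measure `ρ` on the diagonal torus —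
`diag(d) ∈ Ω n ↔ |ord d₀| ≤ n` (★ U2Torus `diag_mem_heightBall_iff`), so `T ∩ Ω n` is covered by the `2n+1` translates `s^{−j}(T ∩ Ω 0)`, `|j| ≤ n`, of the height-zero
part by powers of `s = diag(ϖ, σ(ϖ)⁻¹)` (print: `∫_A Φ da ≤ c (1 + radius)^ℓ` at `ℓ = 1`; same shape as `N = 3`). [cite: HarishChandra1970, Part VII §3 p. 72] [cite: Rogawski1990, §1.10 p. 9] -/
theorem measure_torusU_heightBall_le
    (hmem : ∀ (m : ℕ) (g : ↥(unitaryGroupOfForm σ J)), g ∈ Ω m ↔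
      (∀ i j, Valued.v (ϖ ^ m * ((g : GL (Fin 2) K) : Matrix (Fin 2) (Fin 2) K) i j) ≤ 1) ∧
        ∀ i j, Valued.v (ϖ ^ m * (((g : GL (Fin 2) K)⁻¹ : GL (Fin 2) K) : Matrix (Fin 2) (Fin 2) K) i j) ≤ 1)
    [MeasurableSpace ↥(unitaryGroupOfForm σ J)] [BorelSpace ↥(unitaryGroupOfForm σ J)] (ρ : Measure ↥(torusU σ J)) [ρ.IsMulLeftInvariant] (n : ℕ) :
    ρ {a : ↥(torusU σ J) | (a : ↥(unitaryGroupOfForm σ J)) ∈ Ω n} ≤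
      ((2 * n + 1 : ℕ) : ℝ≥0∞) * ρ {a : ↥(torusU σ J) | (a : ↥(unitaryGroupOfForm σ J)) ∈ Ω 0} := by
  obtain ⟨s, hsT, e, he, he0⟩ := exists_mem_torusU_coe_zero_eq σ hσσ hJ hϖ
  set s' : ↥(torusU σ J) := ⟨s, hsT⟩ with hs'
  set T₀ : Set ↥(torusU σ J) := {a : ↥(torusU σ J) | (a : ↥(unitaryGroupOfForm σ J)) ∈ Ω 0} with hT₀
  -- the cover of `T ∩ Ω n` by `2n+1` left translates of `T₀`
  have hcover : {a : ↥(torusU σ J) | (a : ↥(unitaryGroupOfForm σ J)) ∈ Ω n} ⊆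
      ⋃ j ∈ Finset.Icc (-(n : ℤ)) n, (fun a : ↥(torusU σ J) => s' ^ j * a) ⁻¹' T₀ := by
    intro a ha
    obtain ⟨d, hd⟩ := (mem_torusU_iff (a : ↥(unitaryGroupOfForm σ J))).1 a.2
    have hΩ := (diag_mem_heightBall_iff σ hσv hJ Ω hmem hd n).1 ha
    have hd0 : Valued.v (d 0 : K) ≠ 0 := (Valuation.ne_zero_iff _).2 (d 0).ne_zero
    set L : ℤ := WithZero.log (Valued.v (d 0 : K)) with hL
    have hvd : Valued.v (d 0 : K) = WithZero.exp L := (WithZero.exp_log hd0).symm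
    have hvn : Valued.v (ϖ ^ n) = WithZero.exp (-(n : ℤ)) := CartanUnique.v_uniformizer_pow hϖ n
    refine Set.mem_iUnion₂.2 ⟨L, ?_, ?_⟩
    · -- `|ord d₀| ≤ n`
      rw [Finset.mem_Icc]
      obtain ⟨h₁, h₂⟩ := hΩ
      rw [map_mul, hvn, hvd, ← WithZero.exp_add, ← WithZero.exp_zero, WithZero.exp_le_exp] at h₁
      rw [map_mul, map_inv₀, hvn, hvd, ← WithZero.exp_neg, ← WithZero.exp_add, ← WithZero.exp_zero, WithZero.exp_le_exp] at h₂
      constructor <;> omega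
    · -- `s^L a ∈ T₀`: its first coordinate `ϖ^L d₀` is a unit
      show ((s' ^ L * a : ↥(torusU σ J)) : ↥(unitaryGroupOfForm σ J)) ∈ Ω 0
      have hd' : glDiagonal 2 K (e ^ L * d) = (((s' ^ L * a : ↥(torusU σ J)) : ↥(unitaryGroupOfForm σ J)) : GL (Fin 2) K) := by
        rw [map_mul, map_zpow, he, hd, Subgroup.coe_mul, SubgroupClass.coe_zpow, Subgroup.coe_mul, SubgroupClass.coe_zpow]
      rw [diag_mem_heightBall_iff σ hσv hJ Ω hmem hd' 0, pow_zero, one_mul, one_mul]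
      have hval : Valued.v (((e ^ L * d) 0 : Kˣ) : K) = 1 := by
        rw [Pi.mul_apply, Pi.pow_apply, Units.val_mul, Units.val_zpow_eq_zpow_val, he0, map_mul, map_zpow₀, hϖ, hvd,
          ← WithZero.exp_zsmul, ← WithZero.exp_add, ← WithZero.exp_zero]
        congr 1
        simp
      rw [map_inv₀, hval, inv_one]
      exact ⟨le_rfl, le_rfl⟩
  calc ρ {a : ↥(torusU σ J) | (a : ↥(unitaryGroupOfForm σ J)) ∈ Ω n}
      ≤ ρ (⋃ j ∈ Finset.Icc (-(n : ℤ)) n, (fun a : ↥(torusU σ J) => s' ^ j * a) ⁻¹' T₀) := measure_mono hcover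
    _ ≤ ∑ j ∈ Finset.Icc (-(n : ℤ)) n, ρ ((fun a : ↥(torusU σ J) => s' ^ j * a) ⁻¹' T₀) := measure_biUnion_finset_le _ _
    _ = ∑ j ∈ Finset.Icc (-(n : ℤ)) n, ρ T₀ := Finset.sum_congr rfl fun j _ => measure_preimage_mul ρ (s' ^ j) T₀
    _ = ((2 * n + 1 : ℕ) : ℝ≥0∞) * ρ T₀ := by
      rw [Finset.sum_const, nsmul_eq_mul, Int.card_Icc]
      congr 2
      omega

end Torus

/-! ## §2b Rank-blind lemmas on the diagonal torus of `U(σ, J)(K)` (any size `N`, any form `J`) -/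

section AnyRank

variable {K : Type*} [Field K] (σ : K →+* K) {N : ℕ} {J : Matrix (Fin N) (Fin N) K}

/-- **FIBRE SLICES OF A HEIGHT BALL** (any rank `N`): if `Ω m` is stable under inversion and `Ω a · Ω b ⊆ Ω (a + b)`, `x₀ ∈ Ω h` and `a₀ ∈ T`, then
`{a ∈ T : x₀ a₀ a ∈ Ω R} ⊆ a₀⁻¹ · {a ∈ T : a ∈ Ω (h + R)}` (`a₀ a = x₀⁻¹ (x₀ a₀ a) ∈ Ω h · Ω R`; the `N = 3` template ★ (M5b) states it at `Φ₃` with the same proof).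
[cite: HarishChandra1970, Part VII §3 p. 72] -/
theorem torusU_fibre_subset (Ω : ℕ → Set ↥(unitaryGroupOfForm σ J))
    (hinv : ∀ (m : ℕ) (g : ↥(unitaryGroupOfForm σ J)), g ∈ Ω m → g⁻¹ ∈ Ω m)
    (hmul : ∀ (a b : ℕ) (g h : ↥(unitaryGroupOfForm σ J)), g ∈ Ω a → h ∈ Ω b → g * h ∈ Ω (a + b))
    {x₀ : ↥(unitaryGroupOfForm σ J)} {h : ℕ} (hx₀ : x₀ ∈ Ω h) (a₀ : ↥(torusU σ J)) (R : ℕ) :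
    {a : ↥(torusU σ J) | x₀ * (a₀ : ↥(unitaryGroupOfForm σ J)) * (a : ↥(unitaryGroupOfForm σ J)) ∈ Ω R} ⊆
      (fun a : ↥(torusU σ J) => a₀ * a) ⁻¹' {a : ↥(torusU σ J) | (a : ↥(unitaryGroupOfForm σ J)) ∈ Ω (h + R)} := by
  intro a ha
  show ((a₀ * a : ↥(torusU σ J)) : ↥(unitaryGroupOfForm σ J)) ∈ Ω (h + R)
  have e : ((a₀ * a : ↥(torusU σ J)) : ↥(unitaryGroupOfForm σ J)) =
      x₀⁻¹ * (x₀ * (a₀ : ↥(unitaryGroupOfForm σ J)) * (a : ↥(unitaryGroupOfForm σ J))) := by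
    rw [Subgroup.coe_mul]; group
  rw [e]
  exact hmul h R _ _ (hinv h x₀ hx₀) ha

/-- `T` centralises each of its elements (any rank `N`; the `ht` binder of ★ `descConj` for `t = diag d`, from ★ `torusU_mul_comm`). [cite: Rogawski1990, §1.10 p. 9] -/
theorem torusU_comm_of_glDiagonal {t : ↥(unitaryGroupOfForm σ J)} {d : Fin N → Kˣ} (hd : glDiagonal N K d = (t : GL (Fin N) K)) :
    ∀ a ∈ torusU σ J, a * t = t * a := fun a ha =>
  congrArg Subtype.val (torusU_mul_comm (σ := σ) (J := J) ⟨a, ha⟩ ⟨t, (mem_torusU_iff t).2 ⟨d, hd⟩⟩)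

end AnyRank


/-! ## §3 The conjugator shift (any rank) and the slicing inequality on `U(σ, Φ₂)(K)` -/

section Shift

variable {K : Type*} [Field K] [Valued K ℤᵐ⁰] (σ : K →+* K) {N : ℕ} {J : Matrix (Fin N) (Fin N) K}

/-- **`ρ(T ∩ Ω 0) < ∞`** (any rank `N`) for a measure `ρ` on the torus finite on compacta: the height-zero part of the closed torus is compact (★ `isClosed_torusU_of_t1Space`).
[cite: Rogawski1990, §1.10 p. 9] -/
theorem measure_torusU_heightBall_zero_lt_top [MeasurableSpace ↥(unitaryGroupOfForm σ J)] (Ω : CompactExhaustion ↥(unitaryGroupOfForm σ J))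
    (ρ : Measure ↥(torusU σ J)) [IsFiniteMeasureOnCompacts ρ] :
    ρ {a : ↥(torusU σ J) | (a : ↥(unitaryGroupOfForm σ J)) ∈ Ω 0} < ∞ :=
  ((isClosed_torusU_of_t1Space σ J).isClosedEmbedding_subtypeVal.isCompact_preimage (Ω.isCompact 0)).measure_lt_top

/-- **THE CONJUGATOR SHIFT** (any rank `N`): for `μ` right invariant, `Ω a · Ω b ⊆ Ω (a + b)` and `y ∈ Ω s`, `∫⁻_{Ω R} Θ(x (y t y⁻¹) x⁻¹) dμ ≤ ∫⁻_{Ω (R + s)} Θ(x t x⁻¹) dμ` —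
`x (y t y⁻¹) x⁻¹ = (x y) t (x y)⁻¹`, the substitution `x ↦ x y` (Mathlib `lintegral_mul_right_eq_self`) and `Ω R · y ⊆ Ω (R + s)`. [cite: HarishChandra1970, Part VII §3 p. 71] -/
theorem lintegral_heightBall_conj_conj_le [MeasurableSpace ↥(unitaryGroupOfForm σ J)] (Ω : CompactExhaustion ↥(unitaryGroupOfForm σ J))
    [BorelSpace ↥(unitaryGroupOfForm σ J)] (μ : Measure ↥(unitaryGroupOfForm σ J)) [μ.IsMulRightInvariant]
    (hmul : ∀ (a b : ℕ) (g h : ↥(unitaryGroupOfForm σ J)), g ∈ Ω a → h ∈ Ω b → g * h ∈ Ω (a + b))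
    (Θ : ↥(unitaryGroupOfForm σ J) → ℝ≥0∞) (t : ↥(unitaryGroupOfForm σ J)) {y : ↥(unitaryGroupOfForm σ J)} {s : ℕ} (hy : y ∈ Ω s) (R : ℕ) :
    ∫⁻ x in Ω R, Θ (x * (y * t * y⁻¹) * x⁻¹) ∂μ ≤ ∫⁻ x in Ω (R + s), Θ (x * t * x⁻¹) ∂μ := by
  have hSR : MeasurableSet (Ω R : Set ↥(unitaryGroupOfForm σ J)) := (Ω.isCompact R).measurableSet
  have hS' : MeasurableSet {x : ↥(unitaryGroupOfForm σ J) | x * y⁻¹ ∈ (Ω R : Set ↥(unitaryGroupOfForm σ J))} :=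
    hSR.preimage (measurable_mul_const y⁻¹)
  have h1 : ∫⁻ x in Ω R, Θ (x * (y * t * y⁻¹) * x⁻¹) ∂μ =
      ∫⁻ x in {x : ↥(unitaryGroupOfForm σ J) | x * y⁻¹ ∈ (Ω R : Set ↥(unitaryGroupOfForm σ J))}, Θ (x * t * x⁻¹) ∂μ := by
    rw [← lintegral_indicator hSR, ← lintegral_indicator hS',
      ← lintegral_mul_right_eq_self
        (fun x => ({x : ↥(unitaryGroupOfForm σ J) | x * y⁻¹ ∈ (Ω R : Set ↥(unitaryGroupOfForm σ J))}).indicator (fun x => Θ (x * t * x⁻¹)) x) y]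
    refine lintegral_congr fun x => ?_
    have hconj : x * y * t * (x * y)⁻¹ = x * (y * t * y⁻¹) * x⁻¹ := by group
    by_cases hx : x ∈ (Ω R : Set ↥(unitaryGroupOfForm σ J))
    · have hx' : x * y ∈ {x : ↥(unitaryGroupOfForm σ J) | x * y⁻¹ ∈ (Ω R : Set ↥(unitaryGroupOfForm σ J))} := by
        rw [Set.mem_setOf_eq, mul_inv_cancel_right]; exact hx
      rw [Set.indicator_of_mem hx, Set.indicator_of_mem hx', hconj]
    · have hx' : x * y ∉ {x : ↥(unitaryGroupOfForm σ J) | x * y⁻¹ ∈ (Ω R : Set ↥(unitaryGroupOfForm σ J))} := by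
        rw [Set.mem_setOf_eq, mul_inv_cancel_right]; exact hx
      rw [Set.indicator_of_notMem hx, Set.indicator_of_notMem hx']
  rw [h1]
  refine lintegral_mono_set fun x hx => ?_
  have e : x = x * y⁻¹ * y := by group
  rw [e]
  exact hmul R s _ _ hx hy

end Shift

section Slicing

variable {K : Type*} [Field K] [Valued K ℤᵐ⁰] (σ : K →+* K) (hσv : ∀ x, Valued.v (σ x) = Valued.v x) (hσσ : ∀ x, σ (σ x) = x)
  {J : Matrix (Fin 2) (Fin 2) K} (hJ : J = (StdForm.antidiagonal 2).over K) {ϖ : K} (hϖ : Valued.v ϖ = WithZero.exp (-1 : ℤ))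
  [MeasurableSpace ↥(unitaryGroupOfForm σ J)] [BorelSpace ↥(unitaryGroupOfForm σ J)]
  [SecondCountableTopology ↥(unitaryGroupOfForm σ J)] [LocallyCompactSpace ↥(unitaryGroupOfForm σ J)]
  [hT : IsClosed ((torusU σ J : Subgroup ↥(unitaryGroupOfForm σ J)) : Set ↥(unitaryGroupOfForm σ J))]
  (μ : Measure ↥(unitaryGroupOfForm σ J)) [μ.IsHaarMeasure]
  (ρ : Measure ↥(torusU σ J)) [ρ.IsMulLeftInvariant] [SFinite ρ] [IsFiniteMeasureOnCompacts ρ]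
  [MeasurableSpace (↥(unitaryGroupOfForm σ J) ⧸ torusU σ J)] [BorelSpace (↥(unitaryGroupOfForm σ J) ⧸ torusU σ J)]
  (μQ : Measure (↥(unitaryGroupOfForm σ J) ⧸ torusU σ J))
  [SMulInvariantMeasure ↥(unitaryGroupOfForm σ J) (↥(unitaryGroupOfForm σ J) ⧸ torusU σ J) μQ] [IsFiniteMeasureOnCompacts μQ]
  (Ω : CompactExhaustion ↥(unitaryGroupOfForm σ J))

/-! The instance binder `[hT : IsClosed ↑(torusU σ J)]` (needed to SPELL `unfoldingConstant`) is discharged by `haveI := isClosed_torusU_of_t1Space σ J`. -/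

include hσv hσσ hJ hϖ in
/-- **THE SLICING INEQUALITY AT A TORUS ELEMENT WITH SUPPORT CONTROL.**  `t ∈ T` (centralised by `T`, `ht`), `Θ ≥ 0` Borel with `Θ(x t x⁻¹) ≠ 0 ⇒ x ∈ Ω h · T`
(★ (D2b)₂, or [M4]₂'s `hsupp` with `C = Ω h`): `c · ∫⁻_{x ∈ Ω R} Θ(x t x⁻¹) dμ ≤ (2 (h + R) + 1) · ρ(T ∩ Ω 0) · ∫⁻_{U⧸T} Θ(ẋ t ẋ⁻¹) dμQ(ẋ)` for every `R` — the fibre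
slice through `x = x₀ a₀` (`x₀ ∈ Ω h`) has `ρ`-mass `≤ ρ(T ∩ Ω (h + R)) ≤ (2(h+R)+1) ρ(T ∩ Ω 0)` (§2), then §1. [cite: HarishChandra1970, Part VII §3 pp. 71–72] -/
theorem lintegral_heightBall_conj_le_of_support
    (hmem : ∀ (m : ℕ) (g : ↥(unitaryGroupOfForm σ J)), g ∈ Ω m ↔
      (∀ i j, Valued.v (ϖ ^ m * ((g : GL (Fin 2) K) : Matrix (Fin 2) (Fin 2) K) i j) ≤ 1) ∧
        ∀ i j, Valued.v (ϖ ^ m * (((g : GL (Fin 2) K)⁻¹ : GL (Fin 2) K) : Matrix (Fin 2) (Fin 2) K) i j) ≤ 1)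
    (hinv : ∀ (m : ℕ) (g : ↥(unitaryGroupOfForm σ J)), g ∈ Ω m → g⁻¹ ∈ Ω m)
    (hmul : ∀ (a b : ℕ) (g h : ↥(unitaryGroupOfForm σ J)), g ∈ Ω a → h ∈ Ω b → g * h ∈ Ω (a + b))
    {Θ : ↥(unitaryGroupOfForm σ J) → ℝ≥0∞} (hΘ : Measurable Θ)
    {t : ↥(unitaryGroupOfForm σ J)} (ht : ∀ a ∈ torusU σ J, a * t = t * a) {h : ℕ}
    (hsuppT : ∀ x : ↥(unitaryGroupOfForm σ J), Θ (x * t * x⁻¹) ≠ 0 →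
      x ∈ (Ω h : Set ↥(unitaryGroupOfForm σ J)) * ((torusU σ J : Subgroup ↥(unitaryGroupOfForm σ J)) : Set ↥(unitaryGroupOfForm σ J)))
    (R : ℕ) :
    (unfoldingConstant (torusU σ J) ρ μQ μ : ℝ≥0∞) * ∫⁻ x in Ω R, Θ (x * t * x⁻¹) ∂μ ≤
      ((2 * (h + R) + 1 : ℕ) : ℝ≥0∞) * ρ {a : ↥(torusU σ J) | (a : ↥(unitaryGroupOfForm σ J)) ∈ Ω 0} *
        ∫⁻ q, descConj t (torusU σ J) ht Θ q ∂μQ := by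
  have hSR : MeasurableSet (Ω R : Set ↥(unitaryGroupOfForm σ J)) := (Ω.isCompact R).measurableSet
  refine K2E3TruncatedCharTorusSlicing.lintegral_conj_le_of_fibre_le (torusU σ J) ρ μQ μ t ht hΘ hSR fun x hx => ?_
  obtain ⟨x₀, hx₀, a₀, ha₀, rfl⟩ := Set.mem_mul.1 (hsuppT x hx)
  calc ρ {a : ↥(torusU σ J) | x₀ * a₀ * (a : ↥(unitaryGroupOfForm σ J)) ∈ (Ω R : Set ↥(unitaryGroupOfForm σ J))}
      ≤ ρ ((fun a : ↥(torusU σ J) => (⟨a₀, ha₀⟩ : ↥(torusU σ J)) * a) ⁻¹'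
          {a : ↥(torusU σ J) | (a : ↥(unitaryGroupOfForm σ J)) ∈ Ω (h + R)}) :=
        measure_mono (torusU_fibre_subset σ (⇑Ω) hinv hmul hx₀ ⟨a₀, ha₀⟩ R)
    _ = ρ {a : ↥(torusU σ J) | (a : ↥(unitaryGroupOfForm σ J)) ∈ Ω (h + R)} := measure_preimage_mul ρ _ _
    _ ≤ ((2 * (h + R) + 1 : ℕ) : ℝ≥0∞) * ρ {a : ↥(torusU σ J) | (a : ↥(unitaryGroupOfForm σ J)) ∈ Ω 0} :=
        measure_torusU_heightBall_le σ hσv hσσ hJ hϖ (⇑Ω) hmem ρ (h + R)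

include hσv hσσ hJ hϖ in
/-- **[M5-slice]₂ THE `A`-VOLUME SLICING OF THE TRUNCATED ORBITAL INTEGRAL AT A SPLIT-REGULAR ELEMENT — THE HEAD.**  `t = diag d` REGULAR with root values
`≥ |ϖ^λ|` (`hreg`), `g = y t y⁻¹` with `y ∈ Ω s` (★ (D2a)₂ `exists_conjugator_mem_heightBall` supplies such a `y` of height `2m + 2λ` when `g ∈ Ω m`), `Θ ≥ 0` Borel
supported in `Ω m_θ`, `μ` a left- and right-invariant Haar measure on `U = U(σ, Φ₂)(K)`, `ρ` left invariant on `T`, `μQ` ANY `U`-invariant measure on `U ⧸ T` finite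
on compacta, `c = unfoldingConstant T ρ μQ μ`: for every radius `R`,
`c · ∫⁻_{Ω R} Θ(x g x⁻¹) dμ ≤ (2 (R + s + 2 m_θ + 2λ) + 1) · ρ(T ∩ Ω 0) · ∫⁻_{U⧸T} Θ(ẋ t ẋ⁻¹) dμQ(ẋ)` — print's «`|Θ_T(γ^y)| ≤ ∫_{G⧸A}|θ(γ^x̄)| dx̄ · ∫_A Φ_γ(x a y₀⁻¹) da`,
`∫_A Φ_γ da ≤ c₃(1+|λ(γ)|)^{4ℓ}`» at rank one for `U(1,1)`, constants explicit, linear and VERBATIM those of `N = 3` (conjugator shift + ★ (D2b)₂ currency form `h = 2 m_θ + 2λ` +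
`…_of_support`; the sharp `2 × 2` form `h = m_θ + λ` is `lintegral_heightBall_conj_le_sharp`). [cite: HarishChandra1970, Part VII §3 pp. 71–72] -/
theorem lintegral_heightBall_conj_le
    (hmem : ∀ (m : ℕ) (g : ↥(unitaryGroupOfForm σ J)), g ∈ Ω m ↔
      (∀ i j, Valued.v (ϖ ^ m * ((g : GL (Fin 2) K) : Matrix (Fin 2) (Fin 2) K) i j) ≤ 1) ∧
        ∀ i j, Valued.v (ϖ ^ m * (((g : GL (Fin 2) K)⁻¹ : GL (Fin 2) K) : Matrix (Fin 2) (Fin 2) K) i j) ≤ 1)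
    (hinv : ∀ (m : ℕ) (g : ↥(unitaryGroupOfForm σ J)), g ∈ Ω m → g⁻¹ ∈ Ω m)
    (hmul : ∀ (a b : ℕ) (g h : ↥(unitaryGroupOfForm σ J)), g ∈ Ω a → h ∈ Ω b → g * h ∈ Ω (a + b))
    [μ.IsMulRightInvariant] {Θ : ↥(unitaryGroupOfForm σ J) → ℝ≥0∞} (hΘ : Measurable Θ)
    {mθ : ℕ} (hθ : ∀ g, Θ g ≠ 0 → g ∈ Ω mθ)
    {t : ↥(unitaryGroupOfForm σ J)} (ht : ∀ a ∈ torusU σ J, a * t = t * a) {d : Fin 2 → Kˣ} (hd : glDiagonal 2 K d = (t : GL (Fin 2) K))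
    {lam : ℕ} (hreg : ∀ i k : Fin 2, i ≠ k → Valued.v (ϖ ^ lam) ≤ Valued.v ((d i : K) - d k))
    {y : ↥(unitaryGroupOfForm σ J)} {s : ℕ} (hy : y ∈ Ω s) (R : ℕ) :
    (unfoldingConstant (torusU σ J) ρ μQ μ : ℝ≥0∞) * ∫⁻ x in Ω R, Θ (x * (y * t * y⁻¹) * x⁻¹) ∂μ ≤
      ((2 * (R + s + 2 * mθ + 2 * lam) + 1 : ℕ) : ℝ≥0∞) * ρ {a : ↥(torusU σ J) | (a : ↥(unitaryGroupOfForm σ J)) ∈ Ω 0} *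
        ∫⁻ q, descConj t (torusU σ J) ht Θ q ∂μQ := by
  have hsuppT := K2E3ConjugatorHeightControlRankOneTwo.mem_heightBall_mul_torusU_of_conj_mem_support σ hσv hσσ hJ hϖ (⇑Ω) hmem Θ hθ hd hreg
  have e : 2 * (R + s + 2 * mθ + 2 * lam) + 1 = 2 * ((2 * mθ + 2 * lam) + (R + s)) + 1 := by ring
  rw [e]
  calc (unfoldingConstant (torusU σ J) ρ μQ μ : ℝ≥0∞) * ∫⁻ x in Ω R, Θ (x * (y * t * y⁻¹) * x⁻¹) ∂μ
      ≤ (unfoldingConstant (torusU σ J) ρ μQ μ : ℝ≥0∞) * ∫⁻ x in Ω (R + s), Θ (x * t * x⁻¹) ∂μ :=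
        mul_le_mul' le_rfl (lintegral_heightBall_conj_conj_le σ Ω μ hmul Θ t hy R)
    _ ≤ _ := lintegral_heightBall_conj_le_of_support σ hσv hσσ hJ hϖ μ ρ μQ Ω hmem hinv hmul hΘ ht hsuppT (R + s)

include hσv hσσ hJ hϖ in
/-- **[M5-slice]₂ THE HEAD, SHARP `2 × 2` CONSTANTS**: as `lintegral_heightBall_conj_le` but with the honest `U(1,1)` support radius `h = m_θ + λ` of ★ (D2b)₂
`mem_heightBall_mul_torusU_of_conj_mem_support_sharp` (one root pair, one Lagrange factor): `c · ∫⁻_{Ω R} Θ(x g x⁻¹) dμ ≤ (2 (R + s + m_θ + λ) + 1) · ρ(T ∩ Ω 0) · ∫⁻_{U⧸T} Θ(ẋ t ẋ⁻¹) dμQ`.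
[cite: HarishChandra1970, Part VII §3 pp. 71–72] -/
theorem lintegral_heightBall_conj_le_sharp
    (hmem : ∀ (m : ℕ) (g : ↥(unitaryGroupOfForm σ J)), g ∈ Ω m ↔
      (∀ i j, Valued.v (ϖ ^ m * ((g : GL (Fin 2) K) : Matrix (Fin 2) (Fin 2) K) i j) ≤ 1) ∧
        ∀ i j, Valued.v (ϖ ^ m * (((g : GL (Fin 2) K)⁻¹ : GL (Fin 2) K) : Matrix (Fin 2) (Fin 2) K) i j) ≤ 1)
    (hinv : ∀ (m : ℕ) (g : ↥(unitaryGroupOfForm σ J)), g ∈ Ω m → g⁻¹ ∈ Ω m)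
    (hmul : ∀ (a b : ℕ) (g h : ↥(unitaryGroupOfForm σ J)), g ∈ Ω a → h ∈ Ω b → g * h ∈ Ω (a + b))
    [μ.IsMulRightInvariant] {Θ : ↥(unitaryGroupOfForm σ J) → ℝ≥0∞} (hΘ : Measurable Θ)
    {mθ : ℕ} (hθ : ∀ g, Θ g ≠ 0 → g ∈ Ω mθ)
    {t : ↥(unitaryGroupOfForm σ J)} (ht : ∀ a ∈ torusU σ J, a * t = t * a) {d : Fin 2 → Kˣ} (hd : glDiagonal 2 K d = (t : GL (Fin 2) K))
    {lam : ℕ} (hreg : ∀ i k : Fin 2, i ≠ k → Valued.v (ϖ ^ lam) ≤ Valued.v ((d i : K) - d k))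
    {y : ↥(unitaryGroupOfForm σ J)} {s : ℕ} (hy : y ∈ Ω s) (R : ℕ) :
    (unfoldingConstant (torusU σ J) ρ μQ μ : ℝ≥0∞) * ∫⁻ x in Ω R, Θ (x * (y * t * y⁻¹) * x⁻¹) ∂μ ≤
      ((2 * (R + s + mθ + lam) + 1 : ℕ) : ℝ≥0∞) * ρ {a : ↥(torusU σ J) | (a : ↥(unitaryGroupOfForm σ J)) ∈ Ω 0} *
        ∫⁻ q, descConj t (torusU σ J) ht Θ q ∂μQ := by
  have hsuppT := K2E3ConjugatorHeightControlRankOneTwo.mem_heightBall_mul_torusU_of_conj_mem_support_sharp σ hσv hσσ hJ hϖ (⇑Ω) hmem Θ hθ hd hreg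
  have e : 2 * (R + s + mθ + lam) + 1 = 2 * ((mθ + lam) + (R + s)) + 1 := by ring
  rw [e]
  calc (unfoldingConstant (torusU σ J) ρ μQ μ : ℝ≥0∞) * ∫⁻ x in Ω R, Θ (x * (y * t * y⁻¹) * x⁻¹) ∂μ
      ≤ (unfoldingConstant (torusU σ J) ρ μQ μ : ℝ≥0∞) * ∫⁻ x in Ω (R + s), Θ (x * t * x⁻¹) ∂μ :=
        mul_le_mul' le_rfl (lintegral_heightBall_conj_conj_le σ Ω μ hmul Θ t hy R)
    _ ≤ _ := lintegral_heightBall_conj_le_of_support σ hσv hσσ hJ hϖ μ ρ μQ Ω hmem hinv hmul hΘ ht hsuppT (R + s)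

include hσv hσσ hJ hϖ in
/-- **THE HEAD DIVIDED BY THE WEIL CONSTANT** (`c > 0` as soon as `μQ ≠ 0` and `ρ ≠ 0`, ★ `unfoldingConstant_pos`):
`∫⁻_{Ω R} Θ(x g x⁻¹) dμ ≤ ((2 (R + s + 2 m_θ + 2λ) + 1) · ρ(T ∩ Ω 0) · ∫⁻_{U⧸T} Θ(ẋ t ẋ⁻¹) dμQ) ∕ c` — the shape of the weight `W(g)` of ★ p856355's `hball` before
(D1-split)₂ bounds the quotient integral. [cite: HarishChandra1970, Part VII §3 p. 72] -/
theorem lintegral_heightBall_conj_le_div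
    (hmem : ∀ (m : ℕ) (g : ↥(unitaryGroupOfForm σ J)), g ∈ Ω m ↔
      (∀ i j, Valued.v (ϖ ^ m * ((g : GL (Fin 2) K) : Matrix (Fin 2) (Fin 2) K) i j) ≤ 1) ∧
        ∀ i j, Valued.v (ϖ ^ m * (((g : GL (Fin 2) K)⁻¹ : GL (Fin 2) K) : Matrix (Fin 2) (Fin 2) K) i j) ≤ 1)
    (hinv : ∀ (m : ℕ) (g : ↥(unitaryGroupOfForm σ J)), g ∈ Ω m → g⁻¹ ∈ Ω m)
    (hmul : ∀ (a b : ℕ) (g h : ↥(unitaryGroupOfForm σ J)), g ∈ Ω a → h ∈ Ω b → g * h ∈ Ω (a + b))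
    [μ.IsMulRightInvariant] (hμQ : μQ ≠ 0) (hρ : ρ ≠ 0)
    {Θ : ↥(unitaryGroupOfForm σ J) → ℝ≥0∞} (hΘ : Measurable Θ) {mθ : ℕ} (hθ : ∀ g, Θ g ≠ 0 → g ∈ Ω mθ)
    {t : ↥(unitaryGroupOfForm σ J)} (ht : ∀ a ∈ torusU σ J, a * t = t * a) {d : Fin 2 → Kˣ} (hd : glDiagonal 2 K d = (t : GL (Fin 2) K))
    {lam : ℕ} (hreg : ∀ i k : Fin 2, i ≠ k → Valued.v (ϖ ^ lam) ≤ Valued.v ((d i : K) - d k))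
    {y : ↥(unitaryGroupOfForm σ J)} {s : ℕ} (hy : y ∈ Ω s) (R : ℕ) :
    ∫⁻ x in Ω R, Θ (x * (y * t * y⁻¹) * x⁻¹) ∂μ ≤
      (((2 * (R + s + 2 * mθ + 2 * lam) + 1 : ℕ) : ℝ≥0∞) * ρ {a : ↥(torusU σ J) | (a : ↥(unitaryGroupOfForm σ J)) ∈ Ω 0} *
        ∫⁻ q, descConj t (torusU σ J) ht Θ q ∂μQ) / (unfoldingConstant (torusU σ J) ρ μQ μ : ℝ≥0∞) := by
  have hc : (unfoldingConstant (torusU σ J) ρ μQ μ : ℝ≥0∞) ≠ 0 :=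
    ENNReal.coe_ne_zero.2 (unfoldingConstant_pos (torusU σ J) ρ μQ μ hμQ hρ).ne'
  rw [ENNReal.le_div_iff_mul_le (Or.inl hc) (Or.inl ENNReal.coe_ne_top), mul_comm]
  exact lintegral_heightBall_conj_le σ hσv hσσ hJ hϖ μ ρ μQ Ω hmem hinv hmul hΘ hθ ht hd hreg hy R

include hσv hσσ hJ hϖ in
/-- **THE `ℝ`-VALUED `hball` SHAPE.**  For a CONTINUOUS `θ : U → E` (a supercusp coefficient) supported in `Ω m_θ`, `g = y t y⁻¹` split-regular as above, and a FINITE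
quotient integral `I = ∫⁻_{U⧸T} ‖θ(ẋ t ẋ⁻¹)‖ₑ dμQ` (Theorem 14 at rank one, (D1-split)₂):
`∫_{Ω R} ‖θ(x g x⁻¹)‖ dμ ≤ (((2 (R + s + 2 m_θ + 2λ) + 1) · ρ(T ∩ Ω 0) · I) ∕ c).toReal` — the ball bound `∫_{Bset g} ‖θ(x g x⁻¹)‖ ≤ W g` of ★ p856355 with
`Bset g = Ω R` — THE head (M5e-1)₂ `K2E3SupercuspBallBoundSplitAssemblyTwo` consumes, binders token-for-token with ★ (M5b). [cite: HarishChandra1970, Part VII §3 pp. 71–72; Part VI §8 Theorem 14 p. 60] -/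
theorem integral_heightBall_norm_conj_le
    (hmem : ∀ (m : ℕ) (g : ↥(unitaryGroupOfForm σ J)), g ∈ Ω m ↔
      (∀ i j, Valued.v (ϖ ^ m * ((g : GL (Fin 2) K) : Matrix (Fin 2) (Fin 2) K) i j) ≤ 1) ∧
        ∀ i j, Valued.v (ϖ ^ m * (((g : GL (Fin 2) K)⁻¹ : GL (Fin 2) K) : Matrix (Fin 2) (Fin 2) K) i j) ≤ 1)
    (hinv : ∀ (m : ℕ) (g : ↥(unitaryGroupOfForm σ J)), g ∈ Ω m → g⁻¹ ∈ Ω m)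
    (hmul : ∀ (a b : ℕ) (g h : ↥(unitaryGroupOfForm σ J)), g ∈ Ω a → h ∈ Ω b → g * h ∈ Ω (a + b))
    [μ.IsMulRightInvariant] (hμQ : μQ ≠ 0) (hρ : ρ ≠ 0)
    {E : Type*} [NormedAddCommGroup E] {θ : ↥(unitaryGroupOfForm σ J) → E} (hθc : Continuous θ) {mθ : ℕ} (hθ : ∀ g, θ g ≠ 0 → g ∈ Ω mθ)
    {t : ↥(unitaryGroupOfForm σ J)} (ht : ∀ a ∈ torusU σ J, a * t = t * a) {d : Fin 2 → Kˣ} (hd : glDiagonal 2 K d = (t : GL (Fin 2) K))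
    {lam : ℕ} (hreg : ∀ i k : Fin 2, i ≠ k → Valued.v (ϖ ^ lam) ≤ Valued.v ((d i : K) - d k))
    {y : ↥(unitaryGroupOfForm σ J)} {s : ℕ} (hy : y ∈ Ω s) (R : ℕ)
    (hfin : ∫⁻ q, descConj t (torusU σ J) ht (fun g => ‖θ g‖ₑ) q ∂μQ ≠ ∞) :
    ∫ x in Ω R, ‖θ (x * (y * t * y⁻¹) * x⁻¹)‖ ∂μ ≤
      ((((2 * (R + s + 2 * mθ + 2 * lam) + 1 : ℕ) : ℝ≥0∞) * ρ {a : ↥(torusU σ J) | (a : ↥(unitaryGroupOfForm σ J)) ∈ Ω 0} *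
        ∫⁻ q, descConj t (torusU σ J) ht (fun g => ‖θ g‖ₑ) q ∂μQ) / (unfoldingConstant (torusU σ J) ρ μQ μ : ℝ≥0∞)).toReal := by
  have hc : (unfoldingConstant (torusU σ J) ρ μQ μ : ℝ≥0∞) ≠ 0 :=
    ENNReal.coe_ne_zero.2 (unfoldingConstant_pos (torusU σ J) ρ μQ μ hμQ hρ).ne'
  have hcont : Continuous fun x : ↥(unitaryGroupOfForm σ J) => θ (x * (y * t * y⁻¹) * x⁻¹) :=
    hθc.comp ((continuous_id.mul continuous_const).mul continuous_id.inv)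
  rw [integral_norm_eq_lintegral_enorm hcont.aestronglyMeasurable]
  have hΘ : Measurable fun g : ↥(unitaryGroupOfForm σ J) => ‖θ g‖ₑ := (continuous_enorm.comp hθc).measurable
  have hθ' : ∀ g : ↥(unitaryGroupOfForm σ J), ‖θ g‖ₑ ≠ 0 → g ∈ Ω mθ := fun g hg => hθ g (enorm_ne_zero.1 hg)
  refine ENNReal.toReal_mono ?_ (lintegral_heightBall_conj_le_div σ hσv hσσ hJ hϖ μ ρ μQ Ω hmem hinv hmul hμQ hρ hΘ hθ' ht hd hreg hy R)
  refine ENNReal.div_ne_top (ENNReal.mul_ne_top (ENNReal.mul_ne_top (ENNReal.natCast_ne_top _) ?_) hfin) hc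
  exact (measure_torusU_heightBall_zero_lt_top σ Ω ρ).ne

end Slicing

end Summit.HodgeConjecture.HodgeConjecture.Cruxes.H413.K2E3TruncatedCharTorusSlicingTwo

end
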